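import Summits.Parity.BatemanHorn.Theorems.RoughParitySectorsOddSectorShareLinearOneFormShare
import Summits.Parity.BatemanHorn.Theorems.RoughParitySectorsOddSectorShareLinearIntegerShare
import HarnessLib

/-!
# Route `RoughParitySectors`, crux `OddSectorShareLinear` (stmt-Parity-15629), line `birth`:
# the crux for ONE linear polynomial (`k = 1`: Alladi's cells in one progression) — `stub_shareFinOne`

`--supports stmt-Parity-15629` file.  For a Bateman–Horn system of one linear polynomial `f₀ = αX + β`:
`|c₁·(U e^{−γ}/2) − c_odd| ≤ η·c_odd` for `U ≥ U₀(η)`, eventually in `x` — UNCONDITIONALLY (for `k = 1`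
the decoupling D and the sieve decouplings are identities: `c₁ = P = Q`, `c_odd = O = N`, `W = 1`), from the
landed one-form share S'' (`stub_oneFormShare`) and integer share Z (`stub_integerShare`).

Proof.  For `k = 1` the crux's cells `c₁`, `c_odd` (a filter of the jointly rough set by `∀ i : Fin 1, …`)
are member `0`'s one-form cells `Q`, `N` (`ShareFinOne.card_prime_fin_one`, `ShareFinOne.card_odd_fin_one`:
`Fin.forall_fin_one`).  With `η' = min (η/3) 1`, S'' gives `|Q·O_ℤ − N·P_ℤ| ≤ η'·N·P_ℤ` and Z gives
`|P_ℤ·A − O_ℤ| ≤ η'·O_ℤ` (`A = U e^{−γ}/2`) for `U` large, eventually in `x`; `P_ℤ > 0` for `U ≥ 2`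
(Bertrand, `ShareFinOne.intPrime_pos`), so the two relative errors chain multiplicatively
(`ShareFinOne.chain`) to `|Q·A − N| ≤ 3η'·N ≤ η·N`.  Everything used is PROVED in the tree; no definition
and no new fact is introduced.

References: K. Alladi, Quart. J. Math. Oxford (2) 33 (1982) 129–148 [Alladi1982];
G. Tenenbaum, *Introduction to analytic and probabilistic number theory*, III.6 [Tenenbaum2015].
-/

noncomputable section

open Filter Finset Polynomial
open scoped BigOperators Topology
open Literature.NumberTheory.Sieve

namespace Summit.Parity.BatemanHorn.Cruxes.OddSectorShareLinear.Birth

namespace ShareFinOne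

/-- For one polynomial (`k = 1`) the crux's prime cell `c₁ = #{n ∈ R : ∀ i, Ω(fᵢ(n)) = 1}` is member `0`'s
one-form prime cell `Q₀`. [folklore] -/
theorem card_prime_fin_one (f : Fin 1 → Polynomial ℤ) (x : ℕ) (U : ℝ) :
    (((Finset.Icc 1 x).filter (fun n : ℕ => ∀ i, 0 < (f i).eval (n : ℤ) ∧ ∀ p ∈ Finset.range ⌈(x
    : ℝ) ^ (((f i).natDegree : ℝ) / U)⌉₊, p.Prime → ¬ ((p : ℤ) ∣ (f i).eval (n : ℤ)))).filter (fun n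
    : ℕ => ∀ i, ArithmeticFunction.cardFactors (((f i).eval (n : ℤ)).toNat) = 1)).card =
    ((Finset.Icc 1 x).filter (fun n : ℕ => (0 < (f 0).eval (n : ℤ) ∧ ∀ p ∈
    Finset.range ⌈(x : ℝ) ^ (((f 0).natDegree : ℝ) / U)⌉₊, p.Prime → ¬ ((p : ℤ) ∣ (f 0).eval (n :
    ℤ))) ∧ ArithmeticFunction.cardFactors (((f 0).eval (n : ℤ)).toNat) = 1)).card := by
  congr 1
  ext n
  simp only [Finset.mem_filter, Fin.forall_fin_one, and_assoc]

/-- For one polynomial (`k = 1`) the crux's odd sector `c_odd = #{n ∈ R : ∀ i, Ω(fᵢ(n)) odd}` is member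
`0`'s one-form odd cell `N₀`. [folklore] -/
theorem card_odd_fin_one (f : Fin 1 → Polynomial ℤ) (x : ℕ) (U : ℝ) :
    (((Finset.Icc 1 x).filter (fun n : ℕ => ∀ i, 0 < (f i).eval (n : ℤ) ∧ ∀ p ∈ Finset.range ⌈(x
    : ℝ) ^ (((f i).natDegree : ℝ) / U)⌉₊, p.Prime → ¬ ((p : ℤ) ∣ (f i).eval (n : ℤ)))).filter (fun n
    : ℕ => ∀ i, Odd (ArithmeticFunction.cardFactors (((f i).eval (n : ℤ)).toNat)))).card =
    ((Finset.Icc 1 x).filter (fun n : ℕ => (0 < (f 0).eval (n : ℤ) ∧ ∀ p ∈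
    Finset.range ⌈(x : ℝ) ^ (((f 0).natDegree : ℝ) / U)⌉₊, p.Prime → ¬ ((p : ℤ) ∣ (f 0).eval (n :
    ℤ))) ∧ Odd (ArithmeticFunction.cardFactors (((f 0).eval (n : ℤ)).toNat)))).card := by
  congr 1
  ext n
  simp only [Finset.mem_filter, Fin.forall_fin_one, and_assoc]

/-- The integers' prime cell `P_ℤ = #{1 ≤ n ≤ x : n free of primes < ⌈x^{1/U}⌉₊, Ω(n) = 1}` is
non-empty for `U ≥ 2` and `x ≥ 4` (Bertrand: a prime in `(x/2, x]` exceeds `x^{1/2} ≥ x^{1/U}`).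
[folklore] -/
theorem intPrime_pos {U : ℝ} (hU : 2 ≤ U) : ∀ᶠ x : ℕ in atTop,
    0 < (((Finset.Icc 1 x).filter (fun n : ℕ => ∀ p ∈ Finset.range ⌈(x : ℝ) ^ (1 / U)⌉₊, p.Prime →
    ¬ (p ∣ n))).filter (fun n : ℕ => ArithmeticFunction.cardFactors n = 1)).card := by
  filter_upwards [eventually_ge_atTop 4] with x hx
  obtain ⟨p, hp, hlt, hle⟩ := Nat.exists_prime_lt_and_le_two_mul (x / 2) (by omega)
  have hpx : p ≤ x := hle.trans (Nat.mul_div_le x 2)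
  refine Finset.card_pos.2 ⟨p, ?_⟩
  rw [Finset.mem_filter, Finset.mem_filter, Finset.mem_Icc]
  refine ⟨⟨⟨hp.one_lt.le, hpx⟩, fun q hq hqp hqd => ?_⟩, ArithmeticFunction.cardFactors_apply_prime hp⟩
  have hqp' : q = p := (Nat.prime_dvd_prime_iff_eq hqp hp).1 hqd
  subst hqp'
  have h1 : (q : ℝ) < (x : ℝ) ^ (1 / U) := Nat.lt_ceil.1 (Finset.mem_range.1 hq)
  have hx4 : (4 : ℝ) ≤ x := by exact_mod_cast hx
  have hx1 : (1 : ℝ) ≤ x := by linarith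
  have hx0 : (0 : ℝ) < x := by linarith
  have h2 : (x : ℝ) ^ (1 / U) ≤ (x : ℝ) ^ (1 / 2 : ℝ) :=
    Real.rpow_le_rpow_of_exponent_le hx1 (one_div_le_one_div_of_le (by norm_num) hU)
  have h3 : (x : ℝ) ^ (1 / 2 : ℝ) * (x : ℝ) ^ (1 / 2 : ℝ) = x := by
    rw [← Real.rpow_add hx0]; norm_num
  have hs0 : 0 ≤ (x : ℝ) ^ (1 / 2 : ℝ) := Real.rpow_nonneg hx0.le _
  have h4 : (2 : ℝ) ≤ (x : ℝ) ^ (1 / 2 : ℝ) := by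
    rcases le_or_gt (2 : ℝ) ((x : ℝ) ^ (1 / 2 : ℝ)) with h | h
    · exact h
    · have := mul_self_lt_mul_self hs0 h
      linarith
  have h5 : (x : ℝ) ^ (1 / 2 : ℝ) ≤ x / 2 := by nlinarith
  have h6 : x < 2 * q := by omega
  have h7 : (x : ℝ) < 2 * q := by exact_mod_cast h6
  linarith

/-- Two relative-error statements chain multiplicatively (pure real bookkeeping): with `N, O ≥ 0`,
`P, A > 0` and `0 ≤ η ≤ 1`, from `Q·O ≈ N·P` and `P·A ≈ O` (relative error `η`) follows
`|Q·A − N| ≤ 3η·N`. [folklore] -/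
theorem chain {Q N O P A η : ℝ} (hη0 : 0 ≤ η) (hη1 : η ≤ 1) (hN : 0 ≤ N) (hO : 0 ≤ O)
    (hP : 0 < P) (hA : 0 < A)
    (hS : |Q * O - N * P| ≤ η * (N * P)) (hZ : |P * A - O| ≤ η * O) :
    |Q * A - N| ≤ 3 * η * N := by
  rw [abs_le] at hS hZ ⊢
  obtain ⟨hS1, hS2⟩ := hS
  obtain ⟨hZ1, hZ2⟩ := hZ
  have hPA := mul_pos hP hA
  have hO0 : 0 < O := by
    rcases hO.eq_or_lt with h | h
    · rw [← h] at hZ2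
      linarith
    · exact h
  have h1η : 0 ≤ 1 - η := by linarith
  -- upper bound
  have u2 : Q * O ≤ (1 + η) * (N * P) := by linarith
  have u3 : P * A ≤ (1 + η) * O := by linarith
  have key_u : O * (Q * A) ≤ O * ((1 + η) ^ 2 * N) :=
    calc O * (Q * A) = (Q * O) * A := by ring
      _ ≤ ((1 + η) * (N * P)) * A := mul_le_mul_of_nonneg_right u2 hA.le
      _ = ((1 + η) * N) * (P * A) := by ring
      _ ≤ ((1 + η) * N) * ((1 + η) * O) := mul_le_mul_of_nonneg_left u3 (by positivity)
      _ = O * ((1 + η) ^ 2 * N) := by ring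
  have up : Q * A ≤ (1 + η) ^ 2 * N := le_of_mul_le_mul_left key_u hO0
  -- lower bound
  have l2 : (1 - η) * (N * P) ≤ Q * O := by linarith
  have l3 : (1 - η) * O ≤ P * A := by linarith
  have key_l : O * ((1 - η) ^ 2 * N) ≤ O * (Q * A) :=
    calc O * ((1 - η) ^ 2 * N) = ((1 - η) * N) * ((1 - η) * O) := by ring
      _ ≤ ((1 - η) * N) * (P * A) := mul_le_mul_of_nonneg_left l3 (mul_nonneg h1η hN)
      _ = ((1 - η) * (N * P)) * A := by ring
      _ ≤ (Q * O) * A := mul_le_mul_of_nonneg_right l2 hA.le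
      _ = O * (Q * A) := by ring
  have lo : (1 - η) ^ 2 * N ≤ Q * A := le_of_mul_le_mul_left key_l hO0
  -- polynomial bookkeeping for `η ≤ 1`
  have hsq : η ^ 2 ≤ η := by nlinarith
  have e1 : (1 + η) ^ 2 ≤ 1 + 3 * η := by nlinarith
  have e2 : 1 - 3 * η ≤ (1 - η) ^ 2 := by nlinarith
  have f1 := mul_le_mul_of_nonneg_right e1 hN
  have f2 := mul_le_mul_of_nonneg_right e2 hN
  constructor <;> linarith

end ShareFinOne

/-- **The crux for one linear polynomial (k = 1), unconditionally** — registered sub-goal `stub_shareFinOne`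
of crux stmt-Parity-15629 (line `birth`), verbatim. [folklore] -/
theorem stub_shareFinOne :
    ∀ (f : Fin 1 → Polynomial ℤ), Literature.NumberTheory.Sieve.IsBatemanHornSystem f → (∀ i, (f
    i).natDegree ≤ 1) → ∀ η : ℝ, 0 < η → ∃ U₀ : ℝ, ∀ U : ℝ, U₀ ≤ U → ∀ᶠ x : ℕ in Filter.atTop,
    |(((((Finset.Icc 1 x).filter (fun n : ℕ => ∀ i, 0 < (f i).eval (n : ℤ) ∧ ∀ p ∈ Finset.range ⌈(x
    : ℝ) ^ (((f i).natDegree : ℝ) / U)⌉₊, p.Prime → ¬ ((p : ℤ) ∣ (f i).eval (n : ℤ)))).filter (fun n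
    : ℕ => ∀ i, ArithmeticFunction.cardFactors (((f i).eval (n : ℤ)).toNat) = 1)).card : ℕ) : ℝ) *
    (U * Real.exp (-Real.eulerMascheroniConstant) / 2) ^ 1 - (((((Finset.Icc 1 x).filter (fun n : ℕ
    => ∀ i, 0 < (f i).eval (n : ℤ) ∧ ∀ p ∈ Finset.range ⌈(x : ℝ) ^ (((f i).natDegree : ℝ) / U)⌉₊,
    p.Prime → ¬ ((p : ℤ) ∣ (f i).eval (n : ℤ)))).filter (fun n : ℕ => ∀ i, Odd
    (ArithmeticFunction.cardFactors (((f i).eval (n : ℤ)).toNat)))).card : ℕ) : ℝ)| ≤ η *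
    (((((Finset.Icc 1 x).filter (fun n : ℕ => ∀ i, 0 < (f i).eval (n : ℤ) ∧ ∀ p ∈ Finset.range ⌈(x :
    ℝ) ^ (((f i).natDegree : ℝ) / U)⌉₊, p.Prime → ¬ ((p : ℤ) ∣ (f i).eval (n : ℤ)))).filter (fun n :
    ℕ => ∀ i, Odd (ArithmeticFunction.cardFactors (((f i).eval (n : ℤ)).toNat)))).card : ℕ) : ℝ) := by
  intro f hf hdeg η hη
  have hη' : 0 < min (η / 3) 1 := lt_min (by positivity) one_pos
  obtain ⟨U₁, h₁⟩ := stub_oneFormShare 1 f hf hdeg 0 _ hη'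
  obtain ⟨U₂, h₂⟩ := stub_integerShare _ hη'
  refine ⟨max U₁ (max U₂ 2), fun U hU => ?_⟩
  simp only [max_le_iff] at hU
  obtain ⟨hU₁, hU₂, hU2⟩ := hU
  have hU0 : 0 < U := by linarith
  have hA : 0 < U * Real.exp (-Real.eulerMascheroniConstant) / 2 := by positivity
  filter_upwards [h₁ U hU₁, h₂ U hU₂, ShareFinOne.intPrime_pos hU2] with x hSx hZx hPx
  rw [ShareFinOne.card_prime_fin_one, ShareFinOne.card_odd_fin_one, pow_one]
  have key := ShareFinOne.chain hη'.le (min_le_right _ _) (Nat.cast_nonneg _) (Nat.cast_nonneg _)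
    (by exact_mod_cast hPx) hA hSx hZx
  calc _ ≤ 3 * min (η / 3) 1 * _ := key
    _ ≤ η * _ := by
        apply mul_le_mul_of_nonneg_right _ (Nat.cast_nonneg _)
        linarith [min_le_left (η / 3) 1]

end Summit.Parity.BatemanHorn.Cruxes.OddSectorShareLinear.Birth

end
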